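import Literature.NumberTheory.Automorphic.BaseChangeStrongUnramifiedRankOne
import Literature.NumberTheory.Automorphic.BaseChangeStrongAllFinite
import Literature.NumberTheory.GaloisRepresentations.IdelicLocalNorm
import HarnessLib

/-!
# Arthur–Clozel strong lifting at ALL finite places: the case `n = 1` (proved)

Topic `NumberTheory/Automorphic`; proof file (theorems only: no definition, no named fact, no
instance), companion of `BaseChangeStrongAllFinite`, whose named fact
`ArthurClozel1989_strongLifting_allFinite` (Arthur–Clozel, Ann. of Math. Stud. 120 (1989), Ch. 3,
Thm. 5.1 with the local lifting of unramified representations, Ch. 1 §6, read at EVERY finite place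
`w ∣ v` — `v` ramified in `E` allowed) is XL for `n ≥ 2` (the twisted trace formula).  Here its
**rank-one instance is proved outright**, continuing `BaseChangeStrongUnramifiedRankOne` (the places
unramified in `E`).

For `G = GL(1)`, Shintani's identity (Ch. 1, Def. 6.1) is `Π_w = π_v ∘ N_{E_w/F_v}` and a weak lift
has Hecke character `χ_Π = χ_π ∘ N_{E/F}`
(`AutomorphicRepData.heckeCharacter_eq_baseChange_of_isWeakBaseChangeLiftAE_glOne`).  At ANY finite
`w ∣ v` with `χ_{π,v}` unramified, `χ_{Π,w} = χ_{π,v} ∘ N_{E_w/F_v}` is unramified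
(`HeckeCharacter.isUnramifiedAt_baseChange`) and `χ_{Π,w}(ϖ_w) = χ_{π,v}(N ϖ_w) = χ_{π,v}(ϖ_v)^{f(w|v)}`
because `N_{E_w/F_v} ϖ_w` has `v`-valuation `f(w|v)` — this is relation (1.1) also over the places
ramified in `E/F` (where `f(w|v) = 1` in prime degree).  The new input is the idelic shadow of the
local norm of an arbitrary element of `E_wˣ`:

* `exists_ideleRelNorm_localUnits_eq` — **the idelic norm of a local idele is a local idele**:
  `N_{E/F}(⟨x⟩_w) = ⟨c⟩_v` with `c ∈ F_vˣ` the diagonal value of the semi-local norm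
  `∏_σ σ • (x at w, 1 elsewhere)` of the block above `v` (Cassels–Fröhlich II §11, VII §1.2:
  `(N_{E/F} x)_v = ∏_{w∣v} N_{E_w/F_v} x_w`);
* `valued_pow_eq_of_algebraMap_eq_norm_blockHom_localUnits` — its valuation:
  `|c|_v^{e(w|v)} = |x|_w^{e_v f_v}` (each of the `#D_w = e_v f_v` elements of the decomposition
  group contributes `|x|_w`), whence `|c|_v = |x|_w^{f_v}` (`valued_eq_pow_inertiaDegIn`);
* `HeckeCharacter.IsUnramifiedAt.map_localUnits_eq_pow` — an unramified `χ_v` depends only on the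
  valuation: `χ(⟨c⟩_v) = χ(⟨ϖ_v⟩)^k` when `|c|_v = |ϖ_v|^k`;
* `AutomorphicRepData.hasSatakeParamAt_of_isWeakBaseChangeLiftAE_glOne_allFinite`,
  `ArthurClozel1989_strongLifting_allFinite.rank_one` — **the `n = 1` instance of the named fact**,
  for every finite Galois `E/F` (prime degree and cuspidality not needed in rank one).

## References

* J. Arthur, L. Clozel, *Simple algebras, base change, and the advanced theory of the trace
  formula*, Ann. of Math. Stud. 120 (1989): Ch. 1 §5 (non-inert places), §6.1 Def. 6.1, §6.2;
  Ch. 3 §1 (1.1), Def. 1.1–1.2, Thm. 5.1 (pp. 212–214). [ArthurClozelAMS120]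
* J. W. S. Cassels, A. Fröhlich (eds.), *Algebraic Number Theory* (1967), Ch. II §11 (local norms
  of ideles), Ch. VII §1.1–1.2. [CasselsFrohlichANT1967]
-/

noncomputable section

open scoped MatrixGroups Matrix Classical NumberField
open NumberField IsDedekindDomain Filter
open _root_.Topology

namespace Literature.NumberTheory.Automorphic

open Literature.NumberTheory.GaloisRepresentations

/-! ### §1. The idelic norm of a local idele -/

section LocalIdele

variable {F E : Type} [Field F] [NumberField F] [Field E] [NumberField E] [Algebra F E]
  [IsGalois F E]

/-- **The idelic norm of a local idele is a local idele.**  For `w₀ ∣ v` and `x ∈ E_{w₀}ˣ` let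
`⟨x⟩_{w₀}` be the idele of `E` which is `x` at `w₀` and `1` elsewhere.  Then there is `c ∈ F_vˣ`
with `N_{E/F}(⟨x⟩_{w₀}) = ⟨c⟩_v`, namely the element `c` which, diagonally in `∏_{w∣v} E_w`, is the
semi-local norm `∏_σ σ • (⟨x⟩_{w₀})_v` of the block of `⟨x⟩_{w₀}` above `v` (a `Gal(E/F)`-fixed
element of `∏_{w∣v} E_w` is diagonal): the ideles `(⟨c⟩_v)_E` and `∏_σ σ • ⟨x⟩_{w₀}` have trivial
infinite parts and the same blocks above every finite place of `F`.  (Cassels–Fröhlich II §11: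
`(N_{E/F} y)_v = ∏_{w∣v} N_{E_w/F_v}(y_w)`.) [cite: CasselsFrohlichANT1967, Ch. II §11] -/
theorem exists_ideleRelNorm_localUnits_eq {v : HeightOneSpectrum (𝓞 F)}
    {w₀ : HeightOneSpectrum (𝓞 E)} (hw₀ : w₀.under (𝓞 F) = v) (x : (w₀.adicCompletion E)ˣ) :
    ∃ c : (v.adicCompletion F)ˣ,
      algebraMap (v.adicCompletion F) (SemiLocal F E v) c =
        ((Herbrand.norm (E ≃ₐ[F] E) (IdeleHerbrand.blockHom F E v (localUnits w₀ x)) :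
          (SemiLocal F E v)ˣ) : SemiLocal F E v) ∧
      AdeleRing.ideleRelNorm F E (localUnits w₀ x) = localUnits v c := by
  haveI : FiniteDimensional F E := Module.Finite.of_restrictScalars_finite ℚ F E
  set y : ideleGroup E := localUnits w₀ x with hydef
  set Nv := Herbrand.norm (E ≃ₐ[F] E) (IdeleHerbrand.blockHom F E v y) with hNvdef
  obtain ⟨c, hc⟩ := SemiLocal.exists_eq_algebraMap_of_forall_smul_eq
    ((Nv : (SemiLocal F E v)ˣ) : SemiLocal F E v)
    (fun σ => by rw [← SemiLocal.val_smul_units, Herbrand.smul_norm])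
  -- `c ≠ 0`: its image is a unit of the (non-trivial) semi-local algebra
  have hc0 : c ≠ 0 := by
    intro h0
    obtain ⟨W⟩ := (inferInstance : Nonempty (SemiLocal.Place F E v))
    have h1 := congrFun (Units.mul_inv Nv) W
    rw [Pi.mul_apply, Pi.one_apply, ← hc, h0, map_zero, Pi.zero_apply, zero_mul] at h1
    exact zero_ne_one h1
  refine ⟨Units.mk0 c hc0, hc, ?_⟩
  rw [AdeleRing.ideleRelNorm_eq_iff, ← IdeleHerbrand.norm_eq_ideleGalNorm]
  refine IdeleHerbrand.eq_of_infHom_eq_of_forall_blockHom_eq (F := F) ?_ fun v' => ?_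
  · -- infinite parts are `1`
    have hX : IdeleHerbrand.infHom E
        (AdeleRing.ideleBaseChange F E (localUnits v (Units.mk0 c hc0))) = 1 := by
      apply Units.ext
      show ((AdeleRing.ideleBaseChange F E (localUnits v (Units.mk0 c hc0)) : ideleGroup E) :
        AdeleRing (𝓞 E) E).1 = 1
      rw [AdeleRing.coe_ideleBaseChange, AdeleRing.baseChange_fst, localUnits_fst, map_one]
    have hy : IdeleHerbrand.infHom E y = 1 := Units.ext (localUnits_fst w₀ x)
    have hN : IdeleHerbrand.infHom E (Herbrand.norm (E ≃ₐ[F] E) y) = 1 := by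
      rw [Herbrand.norm_apply, map_prod]
      refine Finset.prod_eq_one fun σ _ => ?_
      rw [IdeleHerbrand.infHom_smul, hy, smul_one]
    rw [hX, hN]
  · by_cases hv' : v' = v
    · subst hv'
      apply Units.ext
      rw [IdeleHerbrand.blockHom_norm, coe_blockHom_ideleBaseChange_localUnits]
      exact hc
    · -- away from `v` both blocks are `1`
      have hX : IdeleHerbrand.blockHom F E v'
          (AdeleRing.ideleBaseChange F E (localUnits v (Units.mk0 c hc0))) = 1 := by
        apply Units.ext
        funext w
        rw [IdeleHerbrand.blockHom_apply, AdeleRing.coe_ideleBaseChange, AdeleRing.baseChange_snd,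
          FiniteAdeleRing.baseChange_apply,
          localUnits_snd_apply_of_ne _ (fun h => hv' (w.under_eq.symm.trans h)), map_one]
        rfl
      have hyv' : IdeleHerbrand.blockHom F E v' y = 1 := by
        apply Units.ext
        funext w
        rw [IdeleHerbrand.blockHom_apply, hydef,
          localUnits_snd_apply_of_ne _ (fun h => hv' (by rw [← hw₀, ← h]; exact w.under_eq.symm))]
        rfl
      have hN : IdeleHerbrand.blockHom F E v' (Herbrand.norm (E ≃ₐ[F] E) y) = 1 := by
        rw [IdeleHerbrand.blockHom_norm, hyv', map_one]
      rw [hX, hN]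

omit [IsGalois F E] in
/-- **The valuation of the local norm.**  If `c ∈ F_v` is, diagonally, the semi-local norm
`∏_σ σ • (⟨x⟩_{w₀})_v` of the block of the local idele `⟨x⟩_{w₀}` (`w₀ ∣ v`, `x ∈ E_{w₀}ˣ`), then
`|c|_v^{e(w₀|v)} = |x|_{w₀}^{#D_{w₀}}`: evaluating at `w₀`, the factor of `σ` is `σ(x)` (valuation
`|x|_{w₀}`) if `σ` fixes `w₀` and `1` otherwise, and the image of `c` in `E_{w₀}` has valuation
`|c|_v^{e(w₀|v)}`. [cite: CasselsFrohlichANT1967, Ch. VII §1.2] -/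
theorem valued_pow_eq_of_algebraMap_eq_norm_blockHom_localUnits {v : HeightOneSpectrum (𝓞 F)}
    {w₀ : HeightOneSpectrum (𝓞 E)} (hw₀ : w₀.under (𝓞 F) = v) (x : (w₀.adicCompletion E)ˣ)
    {c : v.adicCompletion F}
    (hc : algebraMap (v.adicCompletion F) (SemiLocal F E v) c =
      ((Herbrand.norm (E ≃ₐ[F] E) (IdeleHerbrand.blockHom F E v (localUnits w₀ x)) :
        (SemiLocal F E v)ˣ) : SemiLocal F E v)) :
    Valued.v c ^ v.asIdeal.ramificationIdx' w₀.asIdeal =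
      Valued.v (x : w₀.adicCompletion E) ^ Nat.card (MulAction.stabilizer (E ≃ₐ[F] E) w₀) := by
  classical
  set W₀ : SemiLocal.Place F E v := ⟨w₀, hw₀⟩ with hW₀
  have hcW := congrFun hc W₀
  rw [SemiLocal.algebraMap_apply] at hcW
  have hval := congrArg Valued.v hcW
  rw [valued_adicCompletionOfLiesOver] at hval
  -- `hval : |c|^e = | (∏_σ σ • z) w₀ |`
  have hval' : Valued.v c ^ v.asIdeal.ramificationIdx' w₀.asIdeal = _ := hval
  rw [hval', Herbrand.norm_apply, Units.coe_prod, Finset.prod_apply, map_prod]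
  -- the factor of `σ`
  have hfac : ∀ σ : E ≃ₐ[F] E,
      Valued.v (((σ • IdeleHerbrand.blockHom F E v (localUnits w₀ x) : (SemiLocal F E v)ˣ) :
        SemiLocal F E v) W₀) =
        if σ • w₀ = w₀ then Valued.v (x : w₀.adicCompletion E) else 1 := by
    intro σ
    rw [SemiLocal.val_smul_units, SemiLocal.smul_apply, valued_galAdicCompletionMap,
      IdeleHerbrand.blockHom_apply]
    by_cases hσ : σ • w₀ = w₀
    · have hσ' : ((σ⁻¹ • W₀ : SemiLocal.Place F E v) : HeightOneSpectrum (𝓞 E)) = w₀ := by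
        rw [SemiLocal.Place.coe_smul]
        show σ⁻¹ • w₀ = w₀
        rw [inv_smul_eq_iff, hσ]
      rw [if_pos hσ, hσ', localUnits_snd_apply_self]
    · have hσ' : ((σ⁻¹ • W₀ : SemiLocal.Place F E v) : HeightOneSpectrum (𝓞 E)) ≠ w₀ := by
        rw [SemiLocal.Place.coe_smul]
        show σ⁻¹ • w₀ ≠ w₀
        rw [Ne, inv_smul_eq_iff]
        exact fun h => hσ h.symm
      rw [if_neg hσ, localUnits_snd_apply_of_ne _ hσ', map_one]
  simp_rw [hfac]
  rw [Finset.prod_ite, Finset.prod_const_one, mul_one, Finset.prod_const]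
  congr 1
  have h := card_filter_algEquiv_smul_eq' F E w₀ 1
  rw [one_smul] at h
  exact h

/-- **`|c|_v = |x|_{w₀}^{f_v}`** for `c` as above and `E/F` Galois: `#D_{w₀} = e_v f_v`
(`card_stabilizer_algEquiv_eq`) and `e(w₀|v) = e_v`, and `t ↦ t^{e_v}` is injective on the value
group. [cite: CasselsFrohlichANT1967, Ch. VII §1.2] -/
theorem valued_eq_pow_inertiaDegIn_of_algebraMap_eq_norm_blockHom_localUnits
    {v : HeightOneSpectrum (𝓞 F)} {w₀ : HeightOneSpectrum (𝓞 E)} (hw₀ : w₀.under (𝓞 F) = v)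
    (x : (w₀.adicCompletion E)ˣ) {c : v.adicCompletion F}
    (hc : algebraMap (v.adicCompletion F) (SemiLocal F E v) c =
      ((Herbrand.norm (E ≃ₐ[F] E) (IdeleHerbrand.blockHom F E v (localUnits w₀ x)) :
        (SemiLocal F E v)ˣ) : SemiLocal F E v)) :
    Valued.v c = Valued.v (x : w₀.adicCompletion E) ^ v.asIdeal.inertiaDegIn (𝓞 E) := by
  have h := valued_pow_eq_of_algebraMap_eq_norm_blockHom_localUnits hw₀ x hc
  haveI : w₀.asIdeal.LiesOver v.asIdeal := ⟨(congrArg HeightOneSpectrum.asIdeal hw₀).symm⟩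
  haveI : IsGaloisGroup (E ≃ₐ[F] E) (𝓞 F) (𝓞 E) := IsGaloisGroup.of_isFractionRing _ _ _ F E
  have he' : v.asIdeal.ramificationIdx' w₀.asIdeal = v.asIdeal.ramificationIdxIn (𝓞 E) := by
    rw [Ideal.ramificationIdx'_eq_ramificationIdx v.asIdeal w₀.asIdeal v.ne_bot,
      Ideal.ramificationIdxIn_eq_ramificationIdx v.asIdeal w₀.asIdeal (E ≃ₐ[F] E)]
  have hne : v.asIdeal.ramificationIdxIn (𝓞 E) ≠ 0 := by
    rw [← he']
    exact Ideal.IsDedekindDomain.ramificationIdx'_ne_zero_of_liesOver w₀.asIdeal v.ne_bot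
  rw [card_stabilizer_algEquiv_eq, hw₀, he', mul_comm, pow_mul] at h
  exact (pow_left_inj₀ zero_le zero_le hne).mp h

end LocalIdele

/-! ### §2. Unramified quasi-characters depend only on the valuation -/

section Unramified

variable {K : Type} [Field K] [NumberField K]

/-- **An unramified `χ_v` factors through the valuation**: if `χ` is unramified at `v` and
`|c|_v = |ϖ|_v^k` then `χ(⟨c⟩_v) = χ(⟨ϖ⟩_v)^k` (`c = ϖ^k u` with `u ∈ 𝒪_vˣ`).
Tate 1950, §2.3 (unramified quasi-characters of `K_vˣ`). [cite: TateThesis1967, §2.3] -/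
theorem _root_.Literature.NumberTheory.GaloisRepresentations.HeckeCharacter.IsUnramifiedAt.map_localUnits_eq_pow
    {χ : HeckeCharacter K} {v : HeightOneSpectrum (𝓞 K)} (h : χ.IsUnramifiedAt v)
    (c ϖ : (v.adicCompletion K)ˣ) {k : ℕ}
    (hc : Valued.v (c : v.adicCompletion K) = Valued.v (ϖ : v.adicCompletion K) ^ k) :
    χ (localUnits v c) = χ (localUnits v ϖ) ^ k := by
  have hϖ0 : Valued.v (ϖ : v.adicCompletion K) ≠ 0 := (map_ne_zero _).2 ϖ.ne_zero
  have hu : Valued.v ((c * (ϖ ^ k)⁻¹ : (v.adicCompletion K)ˣ) : v.adicCompletion K) = 1 := by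
    rw [Units.val_mul, Units.val_inv_eq_inv_val, Units.val_pow_eq_pow_val, map_mul, map_inv₀,
      map_pow, hc, mul_inv_cancel₀ (pow_ne_zero _ hϖ0)]
  have hceq : c = c * (ϖ ^ k)⁻¹ * ϖ ^ k := (inv_mul_cancel_right c (ϖ ^ k)).symm
  rw [hceq, map_mul, map_mul, map_pow, map_pow, h.map_localUnits_eq_one _ hu, one_mul]

end Unramified

/-! ### §3. Arthur–Clozel's strong lifting at all finite places for `n = 1` -/

section RankOne

variable {F E : Type} [Field F] [NumberField F] [Field E] [NumberField E] [Algebra F E]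
  [IsGalois F E] {hF : isCompact_glFiniteIntegralLevel 1 F} {hE : isCompact_glFiniteIntegralLevel 1 E}

/-- **Relation (1.1) at EVERY finite place, ramified or not, for `GL₁`.**  Let `π = W/W'` on
`GL₁(𝔸_F)` and `Π` on `GL₁(𝔸_E)` be automorphic representation data with `Π` a weak base-change
lift of `π` (`IsWeakBaseChangeLiftAE`), `E/F` Galois.  Then for every finite `w ∣ v` and every
Satake parameter `α = {χ_π(ϖ_v)}` of `π` at `v`, `Π` has Satake parameter `{χ_π(ϖ_v)^{f(w|v)}}`
at `w`: `χ_Π = χ_π ∘ N_{E/F}` is unramified at `w` (`HeckeCharacter.isUnramifiedAt_baseChange`),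
`{χ_Π(ϖ_w)}` is a Satake parameter of `Π` at `w`
(`AutomorphicRepData.hasSatakeParamAt_glOne_of_isUnramifiedAt`), and
`χ_Π(ϖ_w) = χ_π(N_{E/F} ⟨ϖ_w⟩) = χ_π(⟨c⟩_v)` with `|c|_v = |ϖ_w|^{f_v}`, i.e.
`χ_π(ϖ_v)^{f(w|v)}` (`f_v = f(w|v)` for `E/F` Galois).  Arthur–Clozel, Ch. 3, Thm. 5.1 with §1
(1.1), Ch. 1 Def. 6.1 and §5, for `n = 1`.
[cite: ArthurClozelAMS120, Ch. 3 Thm. 5.1 and its proof (pp. 212–214), with §1 (1.1); Ch. 1 Def. 6.1, §5] -/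
theorem AutomorphicRepData.hasSatakeParamAt_of_isWeakBaseChangeLiftAE_glOne_allFinite
    (π : AutomorphicRepData (AutomorphyDatum.gl 1 F hF))
    (P : AutomorphicRepData (AutomorphyDatum.gl 1 E hE)) (hBC : IsWeakBaseChangeLiftAE π P)
    {w : HeightOneSpectrum (𝓞 E)} {v : HeightOneSpectrum (𝓞 F)}
    (hwv : w.asIdeal.under (𝓞 F) = v.asIdeal) {α : Multiset ℂ} (hα : π.HasSatakeParamAt v α) :
    P.HasSatakeParamAt w (α.map (· ^ w.asIdeal.inertiaDeg (𝓞 F))) := by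
  -- Hecke characters, `χ_Π = χ_π ∘ N_{E/F}`
  obtain ⟨χπ, hχπ⟩ := π.exists_heckeCharacter_glOne
  obtain ⟨χP, hχP⟩ := P.exists_heckeCharacter_glOne
  have hbc : χP = χπ.baseChange E :=
    AutomorphicRepData.heckeCharacter_eq_baseChange_of_isWeakBaseChangeLiftAE_glOne hχπ hχP hBC
  -- `α = {χ_π(ϖ_v)}` and `χ_π` is unramified at `v`
  have hurπ : χπ.IsUnramifiedAt v := π.isUnramifiedAt_heckeCharacter_glOne hχπ hα
  obtain ⟨ϖ, hϖ, rfl⟩ := π.exists_eq_singleton_of_hasSatakeParamAt_glOne hχπ hα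
  have hwv' : w.under (𝓞 F) = v := by
    rw [HeightOneSpectrum.ext_iff, HeightOneSpectrum.under_asIdeal]
    exact hwv
  haveI iw : w.asIdeal.LiesOver v.asIdeal := ⟨hwv.symm⟩
  haveI : IsGaloisGroup (E ≃ₐ[F] E) (𝓞 F) (𝓞 E) := IsGaloisGroup.of_isFractionRing _ _ _ F E
  have hfIn : v.asIdeal.inertiaDegIn (𝓞 E) = w.asIdeal.inertiaDeg (𝓞 F) :=
    Ideal.inertiaDegIn_eq_inertiaDeg v.asIdeal w.asIdeal (E ≃ₐ[F] E)
  -- `χ_Π` is unramified at `w`: `{χ_Π(ϖ_w)}` is a Satake parameter of `Π` at `w`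
  have hurP : χP.IsUnramifiedAt w := by
    rw [hbc]
    exact χπ.isUnramifiedAt_baseChange hurπ hwv'
  set ϖw := HeckeCharacter.uniformizer E w with hϖw
  have hP := P.hasSatakeParamAt_glOne_of_isUnramifiedAt hχP hurP
    (HeckeCharacter.valued_uniformizer (K := E) w)
  -- `N_{E/F} ⟨ϖ_w⟩ = ⟨c⟩_v` with `|c|_v = |ϖ_w|^{f} = |ϖ_v|^{f}`
  obtain ⟨c, hc, hrel⟩ := exists_ideleRelNorm_localUnits_eq (F := F) hwv' ϖw
  have hcval : Valued.v (c : v.adicCompletion F) =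
      Valued.v (ϖ : v.adicCompletion F) ^ w.asIdeal.inertiaDeg (𝓞 F) := by
    rw [valued_eq_pow_inertiaDegIn_of_algebraMap_eq_norm_blockHom_localUnits hwv' ϖw hc, hfIn,
      hϖw, HeckeCharacter.valued_uniformizer, hϖ]
  have hval : ((χP (localUnits w ϖw) : ℂˣ) : ℂ) =
      ((χπ (localUnits v ϖ) : ℂˣ) : ℂ) ^ w.asIdeal.inertiaDeg (𝓞 F) := by
    rw [hbc, HeckeCharacter.baseChange_apply, hrel, hurπ.map_localUnits_eq_pow c ϖ hcval,
      Units.val_pow_eq_pow_val]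
  rw [Multiset.map_singleton, ← hval]
  exact hP

/-- **Arthur–Clozel's strong lifting at all finite places, case `n = 1` (proved).**  The literal
rank-one instance of the named fact `ArthurClozel1989_strongLifting_allFinite`
(`BaseChangeStrongAllFinite`; Arthur–Clozel, Ann. of Math. Stud. 120, Ch. 3, Thm. 5.1 and its proof,
with §1 (1.1), Def. 1.1–1.2, Ch. 1 Def. 6.1, §5–§6): for `E/F` Galois of prime degree and cuspidal
data `π` on `GL₁(𝔸_F)`, `Π` on `GL₁(𝔸_E)` with `Π` a weak base-change lift of `π`, every Satake
parameter `α` of `π` at `v` gives the Satake parameter `α^{f(w|v)}` of `Π` at every finite `w ∣ v`,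
also over the places ramified in `E/F`.  (Cuspidality and the prime degree are not used in rank
one.) [cite: ArthurClozelAMS120, Ch. 3 Thm. 5.1 and its proof (pp. 212–214), with §1 (1.1), Def. 1.1–1.2; Ch. 1 Def. 6.1, §5] -/
theorem ArthurClozel1989_strongLifting_allFinite.rank_one
    (F E : Type) [Field F] [NumberField F] [Field E] [NumberField E] [Algebra F E] [IsGalois F E]
    (_hprime : (Module.finrank F E).Prime)
    (hF : isCompact_glFiniteIntegralLevel 1 F) (hE : isCompact_glFiniteIntegralLevel 1 E)
    (π : CuspidalAutomorphicRepData 1 F hF) (P : CuspidalAutomorphicRepData 1 E hE)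
    (hBC : IsWeakBaseChangeLiftAE π.1 P.1)
    (w : HeightOneSpectrum (𝓞 E)) (v : HeightOneSpectrum (𝓞 F)) (α : Multiset ℂ)
    (hwv : w.asIdeal.under (𝓞 F) = v.asIdeal) (hα : π.1.HasSatakeParamAt v α) :
    P.1.HasSatakeParamAt w (α.map (· ^ w.asIdeal.inertiaDeg (𝓞 F))) :=
  π.1.hasSatakeParamAt_of_isWeakBaseChangeLiftAE_glOne_allFinite P.1 hBC hwv hα

end RankOne

end Literature.NumberTheory.Automorphic
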